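import Literature.MathematicalPhysics.QuantumLattice.HubbardGridCharacters
import Literature.MathematicalPhysics.QuantumLattice.HubbardGridCounterQuadratic
import Literature.Probability.LatticeModels.TorusFourierWeightedL1
import HarnessLib

/-!
# Character sums of padded grid symbols of PRODUCT form: three elementary `ℓ¹` bounds, and the position `ℓ¹` norm of the renormalised band

Topic `MathematicalPhysics/QuantumLattice`; companion of `HubbardGridCharacters` (the padded symbol `gridSymbol L M N β p σ` on the product
torus `ℤ/N × (ℤ/L)²` and `sum_norm_gridSub_pullback_row_le`: row sums of a pulled-back normal covariance are bounded by the `ℓ¹` norm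
`Σ_{(a,b)} ‖Σ_{q₀,q⃗} χ_{q₀}(a) χ_{q⃗}(b) G_σ(q₀,q⃗)‖` of the character sum).  For the three pieces of a shell propagator
`1/(−iω+e) = −1/(iω) − e/(iω)² + e²/((iω)²(e−iω))` one needs the `ℓ¹` norm for symbols of three shapes:

* §1 `sum_torusSite_one_dite` (`Σ_i φ(i) = Σ_{q₀} [val q₀ < 2M] φ⟨val q₀⟩`), `gridSymbol` of a product symbol;
* §2 **`sum_sum_norm_charSum_gridSymbol_fst_le`** — a symbol depending on the FREQUENCY only, `p(k,σ) = t(ω_k)`: the character sum is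
  `δ_{b,0}·L²` in space and Plancherel in time gives `≤ L²·N·√((βL²)⁻⁴ Σ_i ‖t i‖²)`;
* §3 **`sum_sum_norm_charSum_gridSymbol_mul_le`** — a product `p(k,σ) = t(ω_k)·u(k⃗)`: `≤ N·((βL²)⁻² Σ_i ‖t i‖)·Σ_b ‖Σ_{q⃗} χ_{q⃗}(b) u(q⃗)‖`
  (sup in time, position `ℓ¹` norm in space);
* §4 **`sum_sum_norm_charSum_gridSymbol_le_card_mul`** — any symbol, crudely: `≤ N·L²·(βL²)⁻² Σ_k ‖p(k,σ)‖`;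
* §5 the position `ℓ¹` norms of the band pieces: `Σ_b ‖Σ_{q⃗} χ_{q⃗}(b) K(p_{q⃗})‖ ≤ L²·coeffNorm 0 K` (`framePosKernel`),
  `torusBand = −4·h_{1,0}`, and **`sum_norm_charSum_nambuXiCT_le`**: `Σ_b ‖Σ_{q⃗} χ_{q⃗}(b) e_K(q⃗)‖ ≤ L²·(4 + |μ| + coeffNorm 0 K)`.

Everything is proved; no definitions, no named facts.

## Sources

G. Benfatto, A. Giuliani, V. Mastropietro, Ann. Henri Poincaré 7 (2006) 809–898, §2.1 (2.3)–(2.5) and footnote ¹, Lemma 2.2 (2.81)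
[`BenfattoGiulianiMastropietro2006`]; G. Benfatto, A. Giuliani, V. Mastropietro, Ann. Henri Poincaré 4 (2003) 137–193, §1.2 (2.10)
[`BenfattoGiulianiMastropietro2003`].  The `[cite: …]` tags LOCATE the construct each statement is about; the statements are elementary.
-/

noncomputable section

namespace Literature.MathematicalPhysics.QuantumLattice

open Finset Complex Literature.Probability.LatticeModels
open scoped ComplexConjugate

variable {L M N : ℕ} [NeZero L] [NeZero N]

/-! ### §1 Sums over the time dual torus and product symbols -/

omit [NeZero L] in
/-- **A Matsubara sum is a padded sum over the time dual torus** (`2M ≤ N`): `Σ_i φ(i) = Σ_{q₀} [val q₀ < 2M] φ⟨val q₀⟩`.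
[cite: BenfattoGiulianiMastropietro2006, §2.1 (2.3)] -/
theorem sum_torusSite_one_dite (hN : 2 * M ≤ N) {E : Type*} [AddCommMonoid E] (φ : MatsubaraIdx M → E) :
    ∑ i : MatsubaraIdx M, φ i = ∑ q₀ : TorusSite 1 N, if h : (q₀ 0).val < 2 * M then φ ⟨(q₀ 0).val, h⟩ else 0 := by
  classical
  have h := sum_freqMomentum_eq_sum_gridTorus (L := 1) hN (fun k : FreqMomentum 1 M => if k.2 = 0 then φ k.1 else 0)
  rw [Fintype.sum_prod_type] at h
  simp only [Fintype.sum_ite_eq'] at h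
  rw [h]
  refine sum_congr rfl fun q₀ _ => ?_
  by_cases hq : (q₀ 0).val < 2 * M
  · simp only [dif_pos hq, Fintype.sum_ite_eq']
  · simp only [dif_neg hq, sum_const_zero]

omit [NeZero L] [NeZero N] in
/-- The padded symbol of a frequency-only symbol does not depend on the momentum. [cite: BenfattoGiulianiMastropietro2006, §2.1 (2.3)] -/
theorem gridSymbol_fst (β : ℝ) (t : MatsubaraIdx M → ℂ) (σ : Fin 2) (q₀ : TorusSite 1 N) (qv : TorusSite 2 L) :
    gridSymbol L M N β (fun ks => t ks.1.1) σ q₀ qv =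
      if h : (q₀ 0).val < 2 * M then ((1 / (β * (L : ℝ) ^ 2) : ℝ) : ℂ) ^ 2 * t ⟨(q₀ 0).val, h⟩ else 0 := rfl

omit [NeZero L] [NeZero N] in
/-- The padded symbol of a product symbol `t(ω)·u(k⃗)` factorises. [cite: BenfattoGiulianiMastropietro2006, §2.1 (2.3)] -/
theorem gridSymbol_mul (β : ℝ) (t : MatsubaraIdx M → ℂ) (u : TorusSite 2 L → ℂ) (σ : Fin 2) (q₀ : TorusSite 1 N) (qv : TorusSite 2 L) :
    gridSymbol L M N β (fun ks => t ks.1.1 * u ks.1.2) σ q₀ qv =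
      (if h : (q₀ 0).val < 2 * M then ((1 / (β * (L : ℝ) ^ 2) : ℝ) : ℂ) ^ 2 * t ⟨(q₀ 0).val, h⟩ else 0) * u qv := by
  rw [gridSymbol]
  split_ifs <;> simp [mul_assoc]

omit [NeZero L] [NeZero N] in
/-- The padded symbol is additive in the symbol. [cite: BenfattoGiulianiMastropietro2006, §2.1 (2.3)] -/
theorem gridSymbol_add (β : ℝ) (p p' : FreqMomentum L M × Fin 2 → ℂ) (σ : Fin 2) (q₀ : TorusSite 1 N) (qv : TorusSite 2 L) :
    gridSymbol L M N β (p + p') σ q₀ qv = gridSymbol L M N β p σ q₀ qv + gridSymbol L M N β p' σ q₀ qv := by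
  simp only [gridSymbol, Pi.add_apply]
  split_ifs <;> ring

omit [NeZero L] [NeZero N] in
/-- The size of the padded symbol. [cite: BenfattoGiulianiMastropietro2006, §2.1 (2.3)] -/
theorem norm_gridSymbol_eq (β : ℝ) (p : FreqMomentum L M × Fin 2 → ℂ) (σ : Fin 2) (q₀ : TorusSite 1 N) (qv : TorusSite 2 L) :
    ‖gridSymbol L M N β p σ q₀ qv‖ =
      if h : (q₀ 0).val < 2 * M then (1 / (β * (L : ℝ) ^ 2)) ^ 2 * ‖p ((⟨(q₀ 0).val, h⟩, qv), σ)‖ else 0 := by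
  rw [gridSymbol]
  split_ifs
  · rw [norm_mul, norm_pow, Complex.norm_real, Real.norm_eq_abs, sq_abs]
  · rw [norm_zero]

/-! ### §2 Frequency-only symbols: `δ` in space, Plancherel in time -/

/-- **`ℓ¹` of the character sum of a frequency-only symbol**: `Σ_{(a,b)} ‖Σ_{q₀,q⃗} χ_{q₀}(a)χ_{q⃗}(b) G(q₀)‖ ≤ L²·N·√((βL²)⁻⁴ Σ_i ‖t i‖²)`
(`2M ≤ N`). [cite: BenfattoGiulianiMastropietro2006, Lemma 2.2 (2.81)] -/
theorem sum_sum_norm_charSum_gridSymbol_fst_le (hN : 2 * M ≤ N) (β : ℝ) (t : MatsubaraIdx M → ℂ) (σ : Fin 2) :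
    ∑ a : TorusSite 1 N, ∑ bv : TorusSite 2 L,
        ‖∑ q₀ : TorusSite 1 N, ∑ qv : TorusSite 2 L, torusChar q₀ a * torusChar qv bv * gridSymbol L M N β (fun ks => t ks.1.1) σ q₀ qv‖ ≤
      (L : ℝ) ^ 2 * ((N : ℝ) * Real.sqrt ((1 / (β * (L : ℝ) ^ 2)) ^ 4 * ∑ i : MatsubaraIdx M, ‖t i‖ ^ 2)) := by
  classical
  set g : TorusSite 1 N → ℂ := fun q₀ => gridSymbol L M N β (fun ks => t ks.1.1) σ q₀ 0 with hg
  have hG : ∀ (q₀ : TorusSite 1 N) (qv : TorusSite 2 L), gridSymbol L M N β (fun ks => t ks.1.1) σ q₀ qv = g q₀ := fun q₀ qv => by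
    simp only [hg, gridSymbol_fst]
  -- the spatial character sum is `L²·δ_{b,0}`
  have hfact : ∀ (a : TorusSite 1 N) (bv : TorusSite 2 L),
      ∑ q₀ : TorusSite 1 N, ∑ qv : TorusSite 2 L, torusChar q₀ a * torusChar qv bv * gridSymbol L M N β (fun ks => t ks.1.1) σ q₀ qv =
        (∑ q₀ : TorusSite 1 N, torusChar q₀ a * g q₀) * (if bv = 0 then (L : ℂ) ^ 2 else 0) := by
    intro a bv
    simp_rw [hG]
    rw [sum_mul]
    refine sum_congr rfl fun q₀ _ => ?_
    rw [← sum_torusChar_left bv, mul_sum]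
    exact sum_congr rfl fun qv _ => by ring
  simp_rw [hfact]
  rw [sum_comm, Fintype.sum_eq_single (0 : TorusSite 2 L) fun bv hbv => by simp [hbv]]
  simp only [if_true, norm_mul, norm_pow, Complex.norm_natCast, ← sum_mul]
  rw [mul_comm]
  refine mul_le_mul_of_nonneg_left ?_ (by positivity)
  -- Plancherel + Cauchy–Schwarz in time (no weight)
  have hS : ∑ q₀ : TorusSite 1 N, ‖g q₀‖ ^ 2 = (1 / (β * (L : ℝ) ^ 2)) ^ 4 * ∑ i : MatsubaraIdx M, ‖t i‖ ^ 2 := by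
    rw [mul_sum, sum_torusSite_one_dite hN (fun i => (1 / (β * (L : ℝ) ^ 2)) ^ 4 * ‖t i‖ ^ 2)]
    refine sum_congr rfl fun q₀ _ => ?_
    rw [hg, norm_gridSymbol_eq]
    split_ifs <;> ring
  have hP := sum_norm_sum_torusChar_le (d := 1) (L := N) (∅ : Finset Unit) (fun _ => 0) (fun _ => 0) (fun _ h => absurd h (by simp)) 0 g
  simp only [Finset.card_empty, zero_smul, add_zero, inv_one, Finset.sum_const, Finset.card_univ, nsmul_eq_mul, mul_one,
    pow_one] at hP
  have hcard : (Fintype.card (TorusSite 1 N) : ℝ) = N := by simp [Fintype.card_pi, ZMod.card]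
  rw [hcard, Real.sqrt_mul (Nat.cast_nonneg N), ← mul_assoc, Real.mul_self_sqrt (Nat.cast_nonneg N), hS] at hP
  exact hP

/-! ### §3 Product symbols: sup in time, position `ℓ¹` in space -/

/-- **`ℓ¹` of the character sum of a product symbol `t(ω)·u(k⃗)`**:
`Σ_{(a,b)} ‖Σ_{q₀,q⃗} χχ G‖ ≤ N·((βL²)⁻² Σ_i ‖t i‖)·Σ_b ‖Σ_{q⃗} χ_{q⃗}(b) u(q⃗)‖` (`2M ≤ N`). [cite: BenfattoGiulianiMastropietro2006, Lemma 2.2 (2.81)] -/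
theorem sum_sum_norm_charSum_gridSymbol_mul_le (hN : 2 * M ≤ N) (β : ℝ) (t : MatsubaraIdx M → ℂ) (u : TorusSite 2 L → ℂ) (σ : Fin 2) :
    ∑ a : TorusSite 1 N, ∑ bv : TorusSite 2 L,
        ‖∑ q₀ : TorusSite 1 N, ∑ qv : TorusSite 2 L,
          torusChar q₀ a * torusChar qv bv * gridSymbol L M N β (fun ks => t ks.1.1 * u ks.1.2) σ q₀ qv‖ ≤
      (N : ℝ) * ((1 / (β * (L : ℝ) ^ 2)) ^ 2 * ∑ i : MatsubaraIdx M, ‖t i‖) *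
        ∑ bv : TorusSite 2 L, ‖∑ qv : TorusSite 2 L, torusChar qv bv * u qv‖ := by
  classical
  set g : TorusSite 1 N → ℂ := fun q₀ =>
    if h : (q₀ 0).val < 2 * M then ((1 / (β * (L : ℝ) ^ 2) : ℝ) : ℂ) ^ 2 * t ⟨(q₀ 0).val, h⟩ else 0 with hg
  have hfact : ∀ (a : TorusSite 1 N) (bv : TorusSite 2 L),
      ∑ q₀ : TorusSite 1 N, ∑ qv : TorusSite 2 L,
          torusChar q₀ a * torusChar qv bv * gridSymbol L M N β (fun ks => t ks.1.1 * u ks.1.2) σ q₀ qv =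
        (∑ q₀ : TorusSite 1 N, torusChar q₀ a * g q₀) * ∑ qv : TorusSite 2 L, torusChar qv bv * u qv := by
    intro a bv
    rw [sum_mul]
    refine sum_congr rfl fun q₀ _ => ?_
    rw [mul_sum]
    refine sum_congr rfl fun qv _ => ?_
    rw [gridSymbol_mul, hg]
    ring
  -- the time factor is bounded by the plain sum `Σ_{q₀} ‖g‖ = (βL²)⁻² Σ_i ‖t i‖`
  have hgsum : ∑ q₀ : TorusSite 1 N, ‖g q₀‖ = (1 / (β * (L : ℝ) ^ 2)) ^ 2 * ∑ i : MatsubaraIdx M, ‖t i‖ := by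
    rw [mul_sum, sum_torusSite_one_dite hN (fun i => (1 / (β * (L : ℝ) ^ 2)) ^ 2 * ‖t i‖)]
    refine sum_congr rfl fun q₀ _ => ?_
    simp only [hg]
    split_ifs
    · rw [norm_mul, norm_pow, Complex.norm_real, Real.norm_eq_abs, sq_abs]
    · rw [norm_zero]
  have htime : ∀ a : TorusSite 1 N, ‖∑ q₀ : TorusSite 1 N, torusChar q₀ a * g q₀‖ ≤ (1 / (β * (L : ℝ) ^ 2)) ^ 2 * ∑ i : MatsubaraIdx M, ‖t i‖ := by
    intro a
    rw [← hgsum]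
    refine (norm_sum_le _ _).trans (sum_le_sum fun q₀ _ => ?_)
    rw [norm_mul, norm_torusChar, one_mul]
  simp_rw [hfact, norm_mul]
  calc ∑ a : TorusSite 1 N, ∑ bv : TorusSite 2 L, ‖∑ q₀ : TorusSite 1 N, torusChar q₀ a * g q₀‖ * ‖∑ qv : TorusSite 2 L, torusChar qv bv * u qv‖
      ≤ ∑ a : TorusSite 1 N, ∑ bv : TorusSite 2 L,
          ((1 / (β * (L : ℝ) ^ 2)) ^ 2 * ∑ i : MatsubaraIdx M, ‖t i‖) * ‖∑ qv : TorusSite 2 L, torusChar qv bv * u qv‖ :=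
        sum_le_sum fun a _ => sum_le_sum fun bv _ => mul_le_mul_of_nonneg_right (htime a) (norm_nonneg _)
    _ = _ := by
        rw [sum_const, card_univ, ← mul_sum, nsmul_eq_mul, ← mul_assoc]
        congr 1
        simp [Fintype.card_pi, ZMod.card]

/-! ### §4 Any symbol, crudely: sup × count -/

/-- **`ℓ¹` of the character sum of any padded symbol, by `|χ| = 1`**: `≤ N·L²·(βL²)⁻² Σ_k ‖p(k,σ)‖` (`2M ≤ N`).
[cite: BenfattoGiulianiMastropietro2006, §2.1 (2.3)] -/
theorem sum_sum_norm_charSum_gridSymbol_le_card_mul (hN : 2 * M ≤ N) (β : ℝ) (p : FreqMomentum L M × Fin 2 → ℂ) (σ : Fin 2) :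
    ∑ a : TorusSite 1 N, ∑ bv : TorusSite 2 L,
        ‖∑ q₀ : TorusSite 1 N, ∑ qv : TorusSite 2 L, torusChar q₀ a * torusChar qv bv * gridSymbol L M N β p σ q₀ qv‖ ≤
      (N : ℝ) * (L : ℝ) ^ 2 * ((1 / (β * (L : ℝ) ^ 2)) ^ 2 * ∑ k : FreqMomentum L M, ‖p (k, σ)‖) := by
  classical
  have hG : ∑ q₀ : TorusSite 1 N, ∑ qv : TorusSite 2 L, ‖gridSymbol L M N β p σ q₀ qv‖ =
      (1 / (β * (L : ℝ) ^ 2)) ^ 2 * ∑ k : FreqMomentum L M, ‖p (k, σ)‖ := by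
    rw [mul_sum, sum_freqMomentum_eq_sum_gridTorus (N := N) hN (fun k => (1 / (β * (L : ℝ) ^ 2)) ^ 2 * ‖p (k, σ)‖)]
    refine sum_congr rfl fun q₀ _ => sum_congr rfl fun qv _ => ?_
    rw [norm_gridSymbol_eq]
  have hpt : ∀ (a : TorusSite 1 N) (bv : TorusSite 2 L),
      ‖∑ q₀ : TorusSite 1 N, ∑ qv : TorusSite 2 L, torusChar q₀ a * torusChar qv bv * gridSymbol L M N β p σ q₀ qv‖ ≤
        (1 / (β * (L : ℝ) ^ 2)) ^ 2 * ∑ k : FreqMomentum L M, ‖p (k, σ)‖ := by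
    intro a bv
    rw [← hG]
    refine (norm_sum_le _ _).trans (sum_le_sum fun q₀ _ => (norm_sum_le _ _).trans (sum_le_sum fun qv _ => ?_))
    rw [norm_mul, norm_mul, norm_torusChar, norm_torusChar, one_mul, one_mul]
  calc _ ≤ ∑ a : TorusSite 1 N, ∑ bv : TorusSite 2 L, (1 / (β * (L : ℝ) ^ 2)) ^ 2 * ∑ k : FreqMomentum L M, ‖p (k, σ)‖ :=
        sum_le_sum fun a _ => sum_le_sum fun bv _ => hpt a bv
    _ = _ := by
        rw [sum_const, sum_const, card_univ, card_univ, nsmul_eq_mul, nsmul_eq_mul]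
        simp [Fintype.card_pi, ZMod.card]
        ring

/-! ### §5 The position `ℓ¹` norms of the band pieces -/

omit [NeZero N] in
/-- **The character sum of a frame is its position kernel**: `Σ_{q⃗} χ_{q⃗}(b) K(p_{q⃗}) = L²·Ǩ_L(−b)`. [cite: BenfattoGiulianiMastropietro2003, §1.2 The model (2.10)] -/
theorem sum_torusChar_mul_eval_eq (K : TrigPolyC4v) (bv : TorusSite 2 L) :
    ∑ qv : TorusSite 2 L, torusChar qv bv * (K.eval (latticeMomentum L qv) : ℂ) = (L : ℂ) ^ 2 * framePosKernel L K (-bv) := by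
  rw [framePosKernel, ← mul_assoc, mul_inv_cancel₀ natCast_pow_ne_zero, one_mul]
  refine sum_congr rfl fun qv _ => ?_
  rw [torusChar_neg_right, Complex.conj_conj, mul_comm]

omit [NeZero N] in
/-- **`Σ_b ‖Σ_{q⃗} χ_{q⃗}(b) K(p_{q⃗})‖ ≤ L²·coeffNorm 0 K`** (the intrinsic `ℓ¹` size of the frame's position kernel).
[cite: BenfattoGiulianiMastropietro2003, §1.2 The model (2.10)] -/
theorem sum_norm_charSum_eval_le (K : TrigPolyC4v) :
    ∑ bv : TorusSite 2 L, ‖∑ qv : TorusSite 2 L, torusChar qv bv * (K.eval (latticeMomentum L qv) : ℂ)‖ ≤ (L : ℝ) ^ 2 * K.coeffNorm 0 := by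
  simp_rw [sum_torusChar_mul_eval_eq, norm_mul, norm_pow, Complex.norm_natCast]
  rw [← mul_sum]
  refine mul_le_mul_of_nonneg_left ?_ (by positivity)
  rw [Fintype.sum_equiv (Equiv.neg (TorusSite 2 L)) (fun z => ‖framePosKernel L K (-z)‖) (fun z => ‖framePosKernel L K z‖)
    (fun z => rfl)]
  exact sum_norm_framePosKernel_le K

omit [NeZero N] in
/-- The character sum of a harmonic is its position kernel: `Σ_{q⃗} χ_{q⃗}(b) h_{m,n}(p_{q⃗}) = L²·ȟ_{m,n}(−b)`. [cite: BenfattoGiulianiMastropietro2003, §1.2 The model (2.10)] -/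
theorem sum_torusChar_mul_harmonic_eq (m n : ℕ) (bv : TorusSite 2 L) :
    ∑ qv : TorusSite 2 L, torusChar qv bv * (TrigPolyC4v.harmonic m n (latticeMomentum L qv) : ℂ) =
      (L : ℂ) ^ 2 * harmonicPosKernel L m n (-bv) := by
  rw [harmonicPosKernel, ← mul_assoc, mul_inv_cancel₀ natCast_pow_ne_zero, one_mul]
  refine sum_congr rfl fun qv _ => ?_
  rw [torusChar_neg_right, Complex.conj_conj, mul_comm]

omit [NeZero L] [NeZero N] in
/-- **The band is `−4` times the first harmonic**: `ε_L(k⃗) = −2(cos p₁ + cos p₂) = −4·h_{1,0}(p_{k⃗})`. [cite: BenfattoGiulianiMastropietro2006, §2.1 (2.3)] -/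
theorem torusBand_eq_neg_four_mul_harmonic (k : TorusSite 2 L) :
    torusBand L k = -4 * TrigPolyC4v.harmonic 1 0 (latticeMomentum L k) := by
  rw [torusBand, TrigPolyC4v.harmonic, Fin.sum_univ_two]
  simp only [Nat.cast_one, one_mul, Nat.cast_zero, zero_mul, Real.cos_zero, mul_one]
  ring

omit [NeZero N] in
/-- **The position `ℓ¹` norm of the renormalised band**: `Σ_b ‖Σ_{q⃗} χ_{q⃗}(b) e_K(q⃗)‖ ≤ L²·(4 + |μ| + coeffNorm 0 K)`
(nearest-neighbour hopping `4`, on-site `|μ|`, the frame's kernel `≤ coeffNorm 0 K`). [cite: BenfattoGiulianiMastropietro2003, §1.2 The model (2.10)] -/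
theorem sum_norm_charSum_nambuXiCT_le (μ : ℝ) (K : TrigPolyC4v) :
    ∑ bv : TorusSite 2 L, ‖∑ qv : TorusSite 2 L, torusChar qv bv * (nambuXiCT L μ K qv : ℂ)‖ ≤ (L : ℝ) ^ 2 * (4 + |μ| + K.coeffNorm 0) := by
  classical
  have hsplit : ∀ bv : TorusSite 2 L, ∑ qv : TorusSite 2 L, torusChar qv bv * (nambuXiCT L μ K qv : ℂ) =
      -4 * ((L : ℂ) ^ 2 * harmonicPosKernel L 1 0 (-bv)) - (μ : ℂ) * (if bv = 0 then (L : ℂ) ^ 2 else 0) -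
        (L : ℂ) ^ 2 * framePosKernel L K (-bv) := by
    intro bv
    rw [← sum_torusChar_mul_harmonic_eq, ← sum_torusChar_left bv, ← sum_torusChar_mul_eval_eq, mul_sum, mul_sum, ← sum_sub_distrib,
      ← sum_sub_distrib]
    refine sum_congr rfl fun qv _ => ?_
    rw [nambuXiCT, torusBand_eq_neg_four_mul_harmonic]
    push_cast
    ring
  simp_rw [hsplit]
  have hpt : ∀ bv : TorusSite 2 L,
      ‖-4 * ((L : ℂ) ^ 2 * harmonicPosKernel L 1 0 (-bv)) - (μ : ℂ) * (if bv = 0 then (L : ℂ) ^ 2 else 0) - (L : ℂ) ^ 2 * framePosKernel L K (-bv)‖ ≤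
        (L : ℝ) ^ 2 * (4 * ‖harmonicPosKernel L 1 0 (-bv)‖) + (L : ℝ) ^ 2 * (|μ| * (if bv = 0 then 1 else 0)) +
          (L : ℝ) ^ 2 * ‖framePosKernel L K (-bv)‖ := by
    intro bv
    refine (norm_sub_le _ _).trans (add_le_add ((norm_sub_le _ _).trans (add_le_add ?_ ?_)) ?_)
    · rw [norm_mul, norm_mul, norm_neg, norm_pow, Complex.norm_natCast, RCLike.norm_ofNat]; linarith
    · rw [norm_mul, Complex.norm_real, Real.norm_eq_abs]
      split_ifs
      · rw [norm_pow, Complex.norm_natCast]; linarith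
      · rw [norm_zero]; simp
    · rw [norm_mul, norm_pow, Complex.norm_natCast]
  refine (sum_le_sum fun bv _ => hpt bv).trans ?_
  rw [sum_add_distrib, sum_add_distrib, ← mul_sum, ← mul_sum, ← mul_sum, ← mul_sum, ← mul_sum, Fintype.sum_ite_eq', mul_one,
    Fintype.sum_equiv (Equiv.neg (TorusSite 2 L)) (fun z => ‖harmonicPosKernel L 1 0 (-z)‖) (fun z => ‖harmonicPosKernel L 1 0 z‖)
      (fun z => rfl),
    Fintype.sum_equiv (Equiv.neg (TorusSite 2 L)) (fun z => ‖framePosKernel L K (-z)‖) (fun z => ‖framePosKernel L K z‖)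
      (fun z => rfl)]
  have h1 := sum_norm_harmonicPosKernel_le (L := L) 1 0
  have h2 := sum_norm_framePosKernel_le (L := L) K
  have hL : (0 : ℝ) ≤ (L : ℝ) ^ 2 := by positivity
  nlinarith [mul_le_mul_of_nonneg_left h1 hL, mul_le_mul_of_nonneg_left h2 hL, abs_nonneg μ]

end Literature.MathematicalPhysics.QuantumLattice
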